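import Literature.AnabelianGeometry.SemiGraphs.ProSigmaClosedSurfaceElastic
import Literature.AnabelianGeometry.SemiGraphs.ProSigmaCompletionTFG
import Literature.AnabelianGeometry.AbsoluteAnabelian.AbsTopIProp23InfiniteIndexProofs
import Literature.AnabelianGeometry.AbsoluteAnabelian.FreeProlRankLinearProofs
import HarnessLib

/-!
# [AbsTopI] Prop 2.2 / Prop 2.3 (i), (ii) AT THE CLOSED-SURFACE MODEL — the node predicates
# `GeomTFG`, `GeomSlimElastic`, `ArithSlimNotElastic` for every extension whose `Δ` is a pro-`Σ`
# completion of `Γ_{g,0}`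

Topic `AnabelianGeometry/AbsoluteAnabelian`, namespace
`Literature.AnabelianGeometry.AbsoluteAnabelian.FundamentalExtension`.  THEOREMS ONLY (no definition,
no named fact).

S. Mochizuki, *Topics in Absolute Anabelian Geometry I* (2012) [AbsTopI], Prop 2.2 p. 18 ("`Δ` …
topologically finitely generated"), Prop 2.3 p. 19 ((i) "`Δ` is slim and elastic"; (ii) "`Π` is
slim, but not elastic") — typed by abc-iut-L4-t4 as the predicates `E.GeomTFG`, `E.GeomSlimElastic`,
`E.ArithSlimNotElastic` of an extension `E : 1 → Δ → Π → G → 1` (FACT-LIST rows F-0240, F-0239,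
F-0238; DAG nodes AbsTopI:Prop2.2, Prop2.3(i), Prop2.3(ii)).  For an ABSTRACT `E` they stay hypotheses
(the geometric origin of `Δ` is not part of the typed datum); this file discharges all three AT THE
MODEL of a proper hyperbolic curve of genus `g ≥ 2`: `Δ` presented as a pro-`Σ` completion
`ι : Γ_{g,0} → Δ` (abc-iut-L3-t1's `IsProSigmaCompletion Sigma ι`), `Σ` a nonempty set of primes —

* `geom_ne_bot_of_isProSigmaCompletion_closedSurfaceGroup` — `Δ ≠ 1` (`δ¹_ℓ(Δ) = 2g ≥ 4`,
  `freeProlRank_eq_of_surfaceGroup`);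
* `prop22_prop23_of_isProSigmaCompletion_closedSurfaceGroup_mlf` / `_nf` — with MLF resp. NF base
  data (`E.MLFBase` / `E.NFBase`): `E.GeomTFG ∧ E.GeomSlimElastic ∧ E.ArithSlimNotElastic`, assembling
  `geomTFG_of_isProSigmaCompletion_puncturedSurfaceGroup` (Prop 2.2 at the model),
  `geomSlimElastic_of_isProSigmaCompletion_closedSurfaceGroup` (Prop 2.3 (i) at the model: slim half
  [AbsAnab] Lemma 1.3.1 / abc-iut-L5/L3, elastic half = rank route) and abc-iut-L4-t4's reductions
  `MLFBase.arithSlimNotElastic'` / `NFBase.arithSlimNotElastic'` (Prop 2.3 (ii)).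

HONEST SCOPE: MODEL-level; punctured (affine) curves = abc-iut-w5-d206's sibling; nothing here bears
on [IUTchIII] Cor. 3.12; typed ≠ proved elsewhere.

## References

* S. Mochizuki, *Topics in Absolute Anabelian Geometry I: Generalities*, J. Math. Sci. Univ. Tokyo 19
  (2012), Prop 2.2 p. 18, Prop 2.3 p. 19. [MochizukiAbsTopI2012]
-/

noncomputable section

namespace Literature.AnabelianGeometry.AbsoluteAnabelian.FundamentalExtension

open Literature.AnabelianGeometry.SemiGraphs.SemiGraphOfAnabelioids
open Literature.GroupTheory.CombinatorialGroupTheory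

variable {E : FundamentalExtension.{0}} {Sigma : Set ℕ} {g : ℕ}

/-- **`Δ ≠ 1` at the model**: a pro-`Σ` completion of `Γ_{g,0}` (`g ≥ 2`, `Σ` containing a prime
`ℓ`) has `δ¹_ℓ = 2g ≥ 4` (`freeProlRank_eq_of_surfaceGroup`), so it surjects onto some `ℤ_ℓ^N`,
`N ≥ 1`, and is nontrivial. [cite: MochizukiAbsTopI2012, Prop 2.3 (i) p.19] -/
theorem geom_ne_bot_of_isProSigmaCompletion_closedSurfaceGroup (E : FundamentalExtension.{0})
    (hS : ∃ ℓ ∈ Sigma, ℓ.Prime) (hg : 2 ≤ g) (ι : PuncturedSurfaceGroup g 0 →* E.geom)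
    (hι : IsProSigmaCompletion Sigma ι) : E.geom ≠ ⊥ := by
  obtain ⟨ℓ, hℓS, hℓ⟩ := hS
  haveI : Fact ℓ.Prime := ⟨hℓ⟩
  haveI : CompactSpace E.geom := isCompact_iff_compactSpace.mp E.isClosed_geom.isCompact
  obtain ⟨e⟩ := IsProSigmaCompletion.nonempty_mulEquiv_puncturedSurfaceGroup_zero g
  have hrank := IsProSigmaCompletion.freeProlRank_eq_of_surfaceGroup hι e hℓS
  have h1 : ((1 : ℕ) : ℕ∞) ≤ freeProlRank E.geom ℓ := by
    rw [hrank]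
    exact_mod_cast (by omega : 1 ≤ 2 * g)
  obtain ⟨N, F, hN, hF⟩ := exists_surjective_of_le_freeProlRank ℓ Nat.one_pos h1
  rw [← Subgroup.nontrivial_iff_ne_bot]
  haveI : Nonempty (Fin N) := ⟨⟨0, by omega⟩⟩
  haveI : Nontrivial (Multiplicative (Fin N → ℤ_[ℓ])) :=
    Multiplicative.ofAdd.injective.nontrivial
  exact hF.nontrivial

/-- **[AbsTopI] Prop 2.2 + Prop 2.3 (i) + Prop 2.3 (ii) at the closed-surface model, MLF base.**
For an extension `1 → Δ → Π → G → 1` with MLF base data `G ≅ G_k` whose `Δ` is presented as a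
pro-`Σ` completion of `Γ_{g,0}` (`g ≥ 2`, `Σ` a nonempty set of primes): `Δ` is topologically finitely
generated, `Δ` is slim and elastic, and `Π` is slim but not elastic — the three typed predicates HOLD.
[cite: MochizukiAbsTopI2012, Prop 2.3 p.19] -/
theorem prop22_prop23_of_isProSigmaCompletion_closedSurfaceGroup_mlf (B : E.MLFBase)
    (hS : Sigma.Nonempty) (hSp : ∀ p ∈ Sigma, p.Prime) (hg : 2 ≤ g)
    (ι : PuncturedSurfaceGroup g 0 →* E.geom) (hι : IsProSigmaCompletion Sigma ι) :
    E.GeomTFG ∧ E.GeomSlimElastic ∧ E.ArithSlimNotElastic := by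
  have htfg : E.GeomTFG := E.geomTFG_of_isProSigmaCompletion_puncturedSurfaceGroup ι hι
  have hse : E.GeomSlimElastic :=
    E.geomSlimElastic_of_isProSigmaCompletion_closedSurfaceGroup hS hSp hg ι hι
  obtain ⟨ℓ, hℓS⟩ := hS
  have hne := E.geom_ne_bot_of_isProSigmaCompletion_closedSurfaceGroup ⟨ℓ, hℓS, hSp ℓ hℓS⟩ hg ι hι
  exact ⟨htfg, hse, B.arithSlimNotElastic' hse.1 hne htfg⟩

/-- **[AbsTopI] Prop 2.2 + Prop 2.3 (i) + Prop 2.3 (ii) at the closed-surface model, NF base** (same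
statement for extensions with number-field base data `G ≅ G_F`).
[cite: MochizukiAbsTopI2012, Prop 2.3 p.19] -/
theorem prop22_prop23_of_isProSigmaCompletion_closedSurfaceGroup_nf (B : E.NFBase)
    (hS : Sigma.Nonempty) (hSp : ∀ p ∈ Sigma, p.Prime) (hg : 2 ≤ g)
    (ι : PuncturedSurfaceGroup g 0 →* E.geom) (hι : IsProSigmaCompletion Sigma ι) :
    E.GeomTFG ∧ E.GeomSlimElastic ∧ E.ArithSlimNotElastic := by
  have htfg : E.GeomTFG := E.geomTFG_of_isProSigmaCompletion_puncturedSurfaceGroup ι hι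
  have hse : E.GeomSlimElastic :=
    E.geomSlimElastic_of_isProSigmaCompletion_closedSurfaceGroup hS hSp hg ι hι
  obtain ⟨ℓ, hℓS⟩ := hS
  have hne := E.geom_ne_bot_of_isProSigmaCompletion_closedSurfaceGroup ⟨ℓ, hℓS, hSp ℓ hℓS⟩ hg ι hι
  exact ⟨htfg, hse, B.arithSlimNotElastic' hse.1 hne htfg⟩

end Literature.AnabelianGeometry.AbsoluteAnabelian.FundamentalExtension

end
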